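/-
Origin: expansion seat `planner-pub-hodgecm-pv12-g9-0`, handover #1 md5 b9953e98fd458177a517058c8916bce5 (301 l., 11 decls); NEW additive leaf; imports tree HodgeCM.PerL34.ArchCFock + Mathlib Analysis.Calculus.Deriv.{Mul,Add,Slope}; NO import rewrite; land any time (no deps in the RUN 31 queue) (`HOME/pub-hodgecm-pv12-g9/lean/Pv12g9/FockTorusOrbitDeriv.lean`, md5 b9953e98, 301 lines);
landed by the gen-8 packager in gate run 31 as `HodgeCM/PerL34/FockTorusOrbitDeriv.lean` (verbatim).
-/
import Summits.HodgeConjecture.HodgeCM.PerL34.ArchCFock_2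
import Mathlib.Analysis.Calculus.Deriv.Mul
import Mathlib.Analysis.Calculus.Deriv.Add
import Mathlib.Analysis.Calculus.Deriv.Slope

/-!
# FockTorusOrbitDeriv — the TORUS directions of the seam-S4 smoothness field `hF` / `smooth` are topology-free

Origin: expansion seat `planner-pub-hodgecm-pv12-g9-0` (unit `pub-hodgecm-pv12-g9`, DAG-node prover #12 gen 9, the
Fock-model seat).  WIP module `Pv12g9.FockTorusOrbitDeriv`; intended final place
`HodgeCM/PerL34/FockTorusOrbitDeriv.lean`; imports the TREE file `HodgeCM.PerL34.ArchCFock` (pv12-g2: `Fock.FockPlaces`,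
`Fock.map_tprod_eq_prod_smul`) and three Mathlib calculus files.  Asserts nothing: no new constants, no `axiom`, no
placeholders, complete proofs; no statement of another seat is restated or edited.  KERNEL throughout (Mathlib + `ArchCFock`);
ZERO cited facts, ZERO hypotheses beyond the explicit binders of each theorem.

## Node / seam

LEMMAS §9 seam **S4**, the ninth field of the analytic side of Lemma 4.1(c) (N29):
* pv12-g4 `ArchC.FockAnalyticBridge.hF : ∀ j f φ p, HasDerivAt (fun s : ℝ => C4a.pointFunctional C P (C.omg (e j s)
  (ins f φ)) p) (C4a.pointFunctional C P (ins f (XR j φ)) p) 0` ([SETUP D5′, FRÉCHET-SMOOTH VECTOR]; print warrant after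
  referee adv2 O14 / O14-R: Poulsen 1972 Prop. 1.2 + Thm. 1.2 p. 93, Folland 1989 p. 165 (4.47) + Thm. (4.45), Reed–Simon I
  App. to §V.3; GAPS pv12g8-1, pv11g9-A7);
* pv11-g9 `ArchC.LinSmoothSide.smooth : ∀ j f φ, Tendsto (fun s : ℝ => ((s:ℝ):ℂ)⁻¹ • (C.omg (e j s) (ins f φ) -
  C.omg (e j 0) (ins f φ))) (𝓝[≠] 0) (𝓝 (ins f (XR j φ)))` (`HOME/pub-hodgecm-pv11-g9/ENDSTATE-S4-SPEC.md` §1).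

PerL v5 (`HOME/inputs/2001/…PerL-v5…tex`), verbatim, l. 517: "invariance ($\langle X\phi,v\rangle=-\langle\phi,Xv\rangle$)
and (b) would make it vanish on all Fock vectors," — the differentiation step along the real directions `X ∈ 𝔲(W_b)`;
ll. 485–486 (L4.1(b)): "$T_b=\U(W_{1,b})\times\U(W_{2,b})$ acts by the character $-w_b$".

## What is proved (and, honestly, what is not)

The real directions `X_j ∈ 𝔲(W)(L₀⊗ℝ) = ⊕_b 𝔲(W_b)` of the two fields split into TORUS directions (tangent to
`T(L₀⊗ℝ) = ∏_b T_b`, `T_b = U(W_{1,b}) × U(W_{2,b})`; in the printed dictionary at `b ∈ Σ₁₂` these are the diagonal matrix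
units `E₀₀, E₁₁` of `𝔲(1,1)_ℂ = 𝔤𝔩₂`, pv12-g6 `printedU11M λ (0,0) / (1,1)`, and at `b ∈ D₁₂ ∪ {ι₁}` ALL of `𝔲(W_b) = 𝔲(2)`
acts on the LINE `𝓕^{κ_b}_b` through characters) and the NON-torus directions (`E₀₁, E₁₀` at `Σ₁₂`: the raising /
lowering operators `𝔭'_±` of PerL ll. 502–504, which `ladder_span` needs and whose one-parameter groups do NOT preserve
the polynomial Fock module — ENDSTATE-S4-SPEC §3).

THIS FILE: for the TORUS directions both fields are KERNEL consequences of the torus-equivariance field `omg_ins`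
(`C.omg (ιT t) (ins f φ) = ins f (pl.ωT t φ)`, [SETUP D4]) and of the differentiability AT THE SCALAR LEVEL of the local
characters along the chosen one-parameter subgroup — in ANY topology on `SK` (normed, through a linear observation `Λ`:
§1–§3 `HasDerivAt` versions; or a bare topological vector space: §4 `Tendsto` version, the literal `smooth` clause), with
NO citation: over an arbitrary `pl : Fock.FockPlaces`, if a curve `γ : ℝ → pl.Tg` acts on each member of a SPANNING
family of pure tensors `⊗_b x_b` of local `ω_b`-eigenvectors by the scalar `∏_b c_b(s)` with `HasDerivAt c_b c'_b 0` and
`c_b 0 = 1`, then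
* `FockPlaces.hasDerivAt_apply_ωT`: `HasDerivAt (fun s => Λ (pl.ωT (γ s) φ)) (Λ (D φ)) 0` for EVERY `φ : pl.F` and every
  ℂ-linear `Λ : pl.F →ₗ[ℂ] E` into a normed ℂ-space, where `D : pl.F →ₗ[ℂ] pl.F` is any linear operator with
  `D (⊗_b x_b) = (∑_b c'_b) • ⊗_b x_b` on the family (the derived weight operator `dω_∞(γ'(0))`);
* `FockPlaces.hasDerivAt_apply_omg`: the `hF`-shaped statement `HasDerivAt (fun s => Λ (omg (e s) (ins φ))) (Λ (ins (D φ))) 0`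
  for ANY action `omg : G → SK → SK`, torus chart `ιT : pl.Tg → G`, linear `ins : pl.F →ₗ[ℂ] SK` with
  `omg (ιT t) (ins φ) = ins (pl.ωT t φ)` and `e s = ιT (γ s)`;
* `FockPlaces.tendsto_slope_omg`: the `smooth`-shaped statement, `SK` a topological ℂ-vector space
  (`IsTopologicalAddGroup SK`, `ContinuousSMul ℂ SK`), no norm, no observation `Λ`.
§1 is the model-free core: a family of endomorphisms acting on a spanning set by differentiable scalars is weakly
differentiable on the whole module (`hasDerivAt_apply_of_smul`, `hasDerivAt_apply_of_span`, `tendsto_slope_of_smul`,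
`tendsto_slope_of_span`).

NOT proved here, and not claimed: anything about the non-torus directions `E₀₁, E₁₀` at `Σ₁₂` — for them the orbit
`s ↦ ω(exp sX)(φ ⊗ Φ_f)` leaves `ins (pl.F)` and the statement is a property of the CONSTRUCTED adelic Weil representation
in the Schwartz topology (O14-R warrant above; kernel pieces in progress in the pv14 lineage: `SchwartzMultiplierDeriv`,
`SchwartzTranslationDeriv`, `SchwartzLinearFlowDeriv`).  The genuine `L²`-Fock-model instances of the torus case are
pv12-g7 `hasDerivAt_fockRep_torusU_exp` / pv12-g8 `hasDerivAt_fockRep_KW/KV/KL` / pv05-g7 `hasDerivAt_fockRep_expUnitary`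
(cited by name only; this file does not import them).

Labels: KERNEL (every declaration below).  PRINT residue: none introduced; the O14-R warrant of `hF`/`smooth` is
UNCHANGED for the non-torus directions and becomes VACUOUS for the torus directions.
-/

noncomputable section

open Filter Topology
open scoped BigOperators

namespace HodgeCM
namespace PerL34
namespace Fock

/-! ## §1  Model-free core: endomorphism families acting by differentiable scalars on a spanning set -/

section Weak

variable {V : Type*} [AddCommGroup V] [Module ℂ V]
variable {E : Type*} [NormedAddCommGroup E] [NormedSpace ℂ E]

/-- If `ρ s` acts on `v` by the scalar `c s` and `c` has derivative `c'` at `0`, then every ℂ-linear observation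
`s ↦ Λ (ρ s v)` has derivative `c' • Λ v` at `0`. -/
theorem hasDerivAt_apply_of_smul (ρ : ℝ → V →ₗ[ℂ] V) {v : V} {c : ℝ → ℂ} {c' : ℂ}
    (hv : ∀ s, ρ s v = c s • v) (hc : HasDerivAt c c' 0) (Λ : V →ₗ[ℂ] E) :
    HasDerivAt (fun s => Λ (ρ s v)) (c' • Λ v) 0 := by
  have h : (fun s => Λ (ρ s v)) = fun s => c s • Λ v := by
    funext s
    rw [hv, map_smul]
  rw [h]
  exact hc.smul_const (Λ v)

/-- Linear extension from a spanning set: the weak derivative statement `HasDerivAt (s ↦ Λ (ρ s φ)) (Λ (D φ)) 0` is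
closed under linear combinations in `φ`, so it passes from a spanning set `S` to every `φ`. -/
theorem hasDerivAt_apply_of_span (ρ : ℝ → V →ₗ[ℂ] V) (D : V →ₗ[ℂ] V) (Λ : V →ₗ[ℂ] E) {S : Set V}
    (hS : Submodule.span ℂ S = ⊤)
    (h : ∀ v ∈ S, HasDerivAt (fun s => Λ (ρ s v)) (Λ (D v)) 0) (φ : V) :
    HasDerivAt (fun s => Λ (ρ s φ)) (Λ (D φ)) 0 := by
  have hφ : φ ∈ Submodule.span ℂ S := by
    rw [hS]
    exact Submodule.mem_top
  induction hφ using Submodule.span_induction with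
  | mem v hv => exact h v hv
  | zero => simpa using (hasDerivAt_const (0 : ℝ) (0 : E))
  | add u w _ _ hu hw => simpa [map_add, Pi.add_def] using hu.add hw
  | smul a u _ hu => simpa [map_smul, Pi.smul_def] using hu.const_smul a

variable {SK : Type*} [AddCommGroup SK] [Module ℂ SK] [TopologicalSpace SK] [IsTopologicalAddGroup SK]
  [ContinuousSMul ℂ SK]

omit [IsTopologicalAddGroup SK] in
/-- TVS version, no norm and no observation: for linear maps `ρ s : V → SK` into a topological ℂ-vector space with
`ρ s v = c s • w`, `HasDerivAt c c' 0` and `c 0 = 1`, the difference quotients `((s:ℝ):ℂ)⁻¹ • (ρ s v - ρ 0 v)` tend to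
`c' • w` along `𝓝[≠] 0`. -/
theorem tendsto_slope_of_smul (ρ : ℝ → V →ₗ[ℂ] SK) {v : V} {w : SK} {c : ℝ → ℂ} {c' : ℂ}
    (hv : ∀ s, ρ s v = c s • w) (hc : HasDerivAt c c' 0) (h0 : c 0 = 1) :
    Tendsto (fun s : ℝ => ((s : ℝ) : ℂ)⁻¹ • (ρ s v - ρ 0 v)) (𝓝[≠] 0) (𝓝 (c' • w)) := by
  have h1 : Tendsto (fun t : ℝ => ((t : ℝ) : ℂ)⁻¹ * (c t - 1)) (𝓝[≠] 0) (𝓝 c') := by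
    have h := hc.tendsto_slope_zero
    simp only [zero_add, h0] at h
    refine h.congr fun t => ?_
    rw [Complex.real_smul, Complex.ofReal_inv]
  have h2 : (fun s : ℝ => ((s : ℝ) : ℂ)⁻¹ • (ρ s v - ρ 0 v)) =
      fun s => (((s : ℝ) : ℂ)⁻¹ * (c s - 1)) • w := by
    funext s
    rw [hv, hv, h0, ← sub_smul, smul_smul]
  rw [h2]
  exact h1.smul_const w

/-- TVS version of the linear extension from a spanning set. -/
theorem tendsto_slope_of_span (ρ : ℝ → V →ₗ[ℂ] SK) (D : V →ₗ[ℂ] SK) {S : Set V}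
    (hS : Submodule.span ℂ S = ⊤)
    (h : ∀ v ∈ S, Tendsto (fun s : ℝ => ((s : ℝ) : ℂ)⁻¹ • (ρ s v - ρ 0 v)) (𝓝[≠] 0) (𝓝 (D v))) (φ : V) :
    Tendsto (fun s : ℝ => ((s : ℝ) : ℂ)⁻¹ • (ρ s φ - ρ 0 φ)) (𝓝[≠] 0) (𝓝 (D φ)) := by
  have hφ : φ ∈ Submodule.span ℂ S := by
    rw [hS]
    exact Submodule.mem_top
  induction hφ using Submodule.span_induction with
  | mem v hv => exact h v hv
  | zero => simpa using tendsto_const_nhds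
  | add u w _ _ hu hw =>
      have e : (fun s : ℝ => ((s : ℝ) : ℂ)⁻¹ • (ρ s (u + w) - ρ 0 (u + w))) =
          fun s => ((s : ℝ) : ℂ)⁻¹ • (ρ s u - ρ 0 u) + ((s : ℝ) : ℂ)⁻¹ • (ρ s w - ρ 0 w) := by
        funext s
        rw [map_add, map_add, ← smul_add]
        congr 1
        abel
      rw [e, map_add]
      exact hu.add hw
  | smul a u _ hu =>
      have e : (fun s : ℝ => ((s : ℝ) : ℂ)⁻¹ • (ρ s (a • u) - ρ 0 (a • u))) =
          fun s => a • (((s : ℝ) : ℂ)⁻¹ • (ρ s u - ρ 0 u)) := by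
        funext s
        rw [map_smul, map_smul, ← smul_sub, smul_comm]
      rw [e, map_smul]
      exact hu.const_smul a

end Weak

/-! ## §2  Scalar calculus: the product of the local characters along the curve -/

/-- `d/ds|₀ ∏_b c_b(s) = ∑_b c'_b` when every `c_b(0) = 1`. -/
theorem hasDerivAt_prod_of_eq_one {ι : Type*} [Fintype ι] [DecidableEq ι] {c : ι → ℝ → ℂ} {c' : ι → ℂ}
    (hc : ∀ b, HasDerivAt (c b) (c' b) 0) (h0 : ∀ b, c b 0 = 1) :
    HasDerivAt (fun s => ∏ b, c b s) (∑ b, c' b) 0 := by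
  have h := HasDerivAt.fun_finsetProd (u := Finset.univ) (x := (0 : ℝ)) (fun b _ => hc b)
  simp only [h0, Finset.prod_const_one, one_smul] at h
  exact h

/-- `∏_b c_b(0) = 1` when every `c_b(0) = 1`. -/
theorem prod_eq_one_of_eq_one {ι : Type*} [Fintype ι] {c : ι → ℝ → ℂ} (h0 : ∀ b, c b 0 = 1) :
    ∏ b, c b 0 = 1 := by
  simp [h0]

/-! ## §3  Torus directions over an arbitrary `FockPlaces`: `hF`-shaped statements -/

namespace FockPlaces

variable (pl : FockPlaces)

/-- A curve `γ` in `T(L₀⊗ℝ) = ∏_b T_b` acts on a pure tensor of local `ω_b`-eigenvectors by the product of the local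
scalars (pv12-g2 `map_tprod_eq_prod_smul`, read along the curve). -/
theorem ωT_tprod_of_eigen (γ : ℝ → pl.Tg) (x : Π b, (pl.loc b).M) (c : pl.RP → ℝ → ℂ)
    (hx : ∀ b s, (pl.loc b).ω (γ s b) (x b) = c b s • x b) (s : ℝ) :
    pl.ωT (γ s) (PiTensorProduct.tprod ℂ x) = (∏ b, c b s) • PiTensorProduct.tprod ℂ x := by
  unfold FockPlaces.ωT
  exact map_tprod_eq_prod_smul (T := fun _ => ℝ) (fun b s => (pl.loc b).ω (γ s b)) c x hx (fun _ => s)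

section Normed

variable {E : Type*} [NormedAddCommGroup E] [NormedSpace ℂ E]

/-- One eigen-tensor: `s ↦ Λ (ω_∞(γ s) ⊗_b x_b)` has derivative `(∑_b c'_b) • Λ (⊗_b x_b)` at `0`. -/
theorem hasDerivAt_apply_ωT_tprod (γ : ℝ → pl.Tg) (x : Π b, (pl.loc b).M) {c : pl.RP → ℝ → ℂ}
    {c' : pl.RP → ℂ} (hx : ∀ b s, (pl.loc b).ω (γ s b) (x b) = c b s • x b)
    (hc : ∀ b, HasDerivAt (c b) (c' b) 0) (h0 : ∀ b, c b 0 = 1) (Λ : pl.F →ₗ[ℂ] E) :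
    HasDerivAt (fun s => Λ (pl.ωT (γ s) (PiTensorProduct.tprod ℂ x)))
      ((∑ b, c' b) • Λ (PiTensorProduct.tprod ℂ x)) 0 :=
  hasDerivAt_apply_of_smul (fun s => pl.ωT (γ s)) (pl.ωT_tprod_of_eigen γ x c hx)
    (hasDerivAt_prod_of_eq_one hc h0) Λ

/-- **Torus directions of `hF` are topology-free (Fock side).**  If the curve `γ : ℝ → T(L₀⊗ℝ)` acts on each member
`⊗_b x_{i,b}` of a SPANNING family of pure tensors of local eigenvectors by `∏_b c_{i,b}(s)` with
`HasDerivAt c_{i,b} c'_{i,b} 0`, `c_{i,b}(0) = 1`, and `D` is a linear operator with `D (⊗_b x_{i,b}) = (∑_b c'_{i,b}) •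
⊗_b x_{i,b}` (the derived weight operator), then for EVERY `φ ∈ 𝓕^κ_∞` and every ℂ-linear observation `Λ` into a
normed space, `s ↦ Λ (ω_∞(γ s) φ)` has derivative `Λ (D φ)` at `s = 0`. -/
theorem hasDerivAt_apply_ωT (γ : ℝ → pl.Tg) {ιS : Type*} (x : ιS → Π b, (pl.loc b).M)
    (hspan : Submodule.span ℂ (Set.range fun i => PiTensorProduct.tprod ℂ (x i)) = ⊤)
    {c : ιS → pl.RP → ℝ → ℂ} {c' : ιS → pl.RP → ℂ}
    (hx : ∀ i b s, (pl.loc b).ω (γ s b) (x i b) = c i b s • x i b)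
    (hc : ∀ i b, HasDerivAt (c i b) (c' i b) 0) (h0 : ∀ i b, c i b 0 = 1)
    (D : pl.F →ₗ[ℂ] pl.F)
    (hD : ∀ i, D (PiTensorProduct.tprod ℂ (x i)) = (∑ b, c' i b) • PiTensorProduct.tprod ℂ (x i))
    (Λ : pl.F →ₗ[ℂ] E) (φ : pl.F) :
    HasDerivAt (fun s => Λ (pl.ωT (γ s) φ)) (Λ (D φ)) 0 := by
  refine hasDerivAt_apply_of_span (fun s => pl.ωT (γ s)) D Λ hspan ?_ φ
  rintro _ ⟨i, rfl⟩
  rw [hD, map_smul]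
  exact pl.hasDerivAt_apply_ωT_tprod γ (x i) (hx i) (hc i) (h0 i) Λ

/-- **`hF`-shaped corollary (seam S4, torus directions).**  For ANY action `omg : G → SK → SK` of a group on a
ℂ-module `SK`, torus chart `ιT : T(L₀⊗ℝ) → G` and ℂ-linear `ins : 𝓕^κ_∞ → SK` with the [SETUP D4] equivariance
`omg (ιT t) (ins φ) = ins (ω_∞(t) φ)` (`omg_ins`), along a curve `e s = ιT (γ s)` as in `hasDerivAt_apply_ωT`:
`s ↦ Λ (omg (e s) (ins φ))` has derivative `Λ (ins (D φ))` at `0`, for every φ and every linear observation `Λ` of `SK`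
into a normed space (e.g. `Λ = (Φ ↦ 𝒯_Φ(·)(g))`, the `pointFunctional` of `hF`). -/
theorem hasDerivAt_apply_omg {G SK : Type*} [AddCommGroup SK] [Module ℂ SK]
    (omg : G → SK → SK) (ιT : pl.Tg → G) (ins : pl.F →ₗ[ℂ] SK)
    (omg_ins : ∀ (t : pl.Tg) (φ : pl.F), omg (ιT t) (ins φ) = ins (pl.ωT t φ))
    (e : ℝ → G) (γ : ℝ → pl.Tg) (he : ∀ s, e s = ιT (γ s))
    {ιS : Type*} (x : ιS → Π b, (pl.loc b).M)
    (hspan : Submodule.span ℂ (Set.range fun i => PiTensorProduct.tprod ℂ (x i)) = ⊤)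
    {c : ιS → pl.RP → ℝ → ℂ} {c' : ιS → pl.RP → ℂ}
    (hx : ∀ i b s, (pl.loc b).ω (γ s b) (x i b) = c i b s • x i b)
    (hc : ∀ i b, HasDerivAt (c i b) (c' i b) 0) (h0 : ∀ i b, c i b 0 = 1)
    (D : pl.F →ₗ[ℂ] pl.F)
    (hD : ∀ i, D (PiTensorProduct.tprod ℂ (x i)) = (∑ b, c' i b) • PiTensorProduct.tprod ℂ (x i))
    (Λ : SK →ₗ[ℂ] E) (φ : pl.F) :
    HasDerivAt (fun s => Λ (omg (e s) (ins φ))) (Λ (ins (D φ))) 0 := by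
  have h := pl.hasDerivAt_apply_ωT γ x hspan hx hc h0 D hD (Λ ∘ₗ ins) φ
  have hfun : (fun s => Λ (omg (e s) (ins φ))) = fun s => (Λ ∘ₗ ins) (pl.ωT (γ s) φ) := by
    funext s
    rw [he, omg_ins, LinearMap.comp_apply]
  rw [hfun]
  simpa only [LinearMap.comp_apply] using h

end Normed

/-! ## §4  Torus directions over an arbitrary `FockPlaces`: the literal `smooth` clause in a bare TVS -/

section TVS

variable {SK : Type*} [AddCommGroup SK] [Module ℂ SK] [TopologicalSpace SK] [IsTopologicalAddGroup SK]
  [ContinuousSMul ℂ SK]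

/-- **`smooth`-shaped corollary (seam S4, torus directions; pv11-g9 `LinSmoothSide.smooth` verbatim shape).**  Same
hypotheses as `hasDerivAt_apply_omg`, `SK` now only a topological ℂ-vector space:
`Tendsto (fun s => ((s:ℝ):ℂ)⁻¹ • (omg (e s) (ins φ) - omg (e 0) (ins φ))) (𝓝[≠] 0) (𝓝 (ins (D φ)))` for EVERY `φ`. -/
theorem tendsto_slope_omg {G : Type*}
    (omg : G → SK → SK) (ιT : pl.Tg → G) (ins : pl.F →ₗ[ℂ] SK)
    (omg_ins : ∀ (t : pl.Tg) (φ : pl.F), omg (ιT t) (ins φ) = ins (pl.ωT t φ))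
    (e : ℝ → G) (γ : ℝ → pl.Tg) (he : ∀ s, e s = ιT (γ s))
    {ιS : Type*} (x : ιS → Π b, (pl.loc b).M)
    (hspan : Submodule.span ℂ (Set.range fun i => PiTensorProduct.tprod ℂ (x i)) = ⊤)
    {c : ιS → pl.RP → ℝ → ℂ} {c' : ιS → pl.RP → ℂ}
    (hx : ∀ i b s, (pl.loc b).ω (γ s b) (x i b) = c i b s • x i b)
    (hc : ∀ i b, HasDerivAt (c i b) (c' i b) 0) (h0 : ∀ i b, c i b 0 = 1)
    (D : pl.F →ₗ[ℂ] pl.F)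
    (hD : ∀ i, D (PiTensorProduct.tprod ℂ (x i)) = (∑ b, c' i b) • PiTensorProduct.tprod ℂ (x i))
    (φ : pl.F) :
    Tendsto (fun s : ℝ => ((s : ℝ) : ℂ)⁻¹ • (omg (e s) (ins φ) - omg (e 0) (ins φ))) (𝓝[≠] 0)
      (𝓝 (ins (D φ))) := by
  -- read the model orbit through `omg_ins`: it is `s ↦ (ins ∘ ω_∞(γ s)) φ`, a family of linear maps `pl.F → SK`
  have hfun : (fun s : ℝ => ((s : ℝ) : ℂ)⁻¹ • (omg (e s) (ins φ) - omg (e 0) (ins φ))) =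
      fun s => ((s : ℝ) : ℂ)⁻¹ • ((ins ∘ₗ pl.ωT (γ s)) φ - (ins ∘ₗ pl.ωT (γ 0)) φ) := by
    funext s
    rw [he, he, omg_ins, omg_ins, LinearMap.comp_apply, LinearMap.comp_apply]
  rw [hfun, ← LinearMap.comp_apply (f := ins) (g := D)]
  refine tendsto_slope_of_span (fun s => ins ∘ₗ pl.ωT (γ s)) (ins ∘ₗ D) hspan ?_ φ
  rintro _ ⟨i, rfl⟩
  have hv : ∀ s, (ins ∘ₗ pl.ωT (γ s)) (PiTensorProduct.tprod ℂ (x i)) =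
      (∏ b, c i b s) • ins (PiTensorProduct.tprod ℂ (x i)) := by
    intro s
    rw [LinearMap.comp_apply, pl.ωT_tprod_of_eigen γ (x i) (c i) (hx i) s, map_smul]
  have h := tendsto_slope_of_smul (fun s => ins ∘ₗ pl.ωT (γ s)) hv
    (hasDerivAt_prod_of_eq_one (hc i) (h0 i)) (prod_eq_one_of_eq_one (h0 i))
  have hD' : (ins ∘ₗ D) (PiTensorProduct.tprod ℂ (x i)) = (∑ b, c' i b) • ins (PiTensorProduct.tprod ℂ (x i)) := by
    rw [LinearMap.comp_apply, hD, map_smul]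
  dsimp only
  rw [hD']
  exact h

end TVS

end FockPlaces

end Fock
end PerL34
end HodgeCM
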